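import Mathlib
import Summits.ResolutionOfSingularities.ResolutionOfSingularities.Theorems.HomologicalConductorPersistenceSurfacePlateauSyzygy
import Summits.ResolutionOfSingularities.ResolutionOfSingularities.Theorems.HomologicalConductorPersistenceKC3WitnessBaseChange
import Summits.ResolutionOfSingularities.ResolutionOfSingularities.Theorems.HomologicalConductorPersistenceFrobeniusOrderLocal
import HarnessLib

/-!
# Rung S-2 `PersistenceSurface` (stmt-ResolutionOfSingularities-19970) — the plateau certificate AFTER FLAT BASE CHANGE:
# `z^a ∉ caˢ(Λ')` for every flat noetherian `A_n`-algebra `Λ'` that still sees `k[z]/(z^{n+1})`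

Route `ResolutionOfSingularities/HomologicalConductor` (cell decomp-res, hand leafhand-res-homologicalconduct-23 g0).
OURS: AI-written, weaker than expert review; nothing here is a statement of the manuscript under review (Hironaka 2017);
no crux, kill test or summit statement is proved.  SUPPORT level, def-free, fact-free.

`…PlateauSyzygy` gives `z^a ∉ caˢ(Λ_n)` for the GLOBAL `A_n` ring `Λ_n = k[u,w,z]/(uw − z^{n+1})`.  A plateau refutation of
`PersistenceSurface` needs the statement at a LOCAL ring — the tower stage `T_1 = O_{X',P}` at an `A_n` point `P` — which is
(a localisation of an étale neighbour of) `Λ_n`, in any case a FLAT `Λ_n`-algebra.  The K-C3 pattern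
(`…FrobeniusOrderLocal`, `…KC3WitnessBaseChange`) transports both ingredients along a flat base change: infinite syzygies
base-change (`not_mem_cohomologyAnnihilatorOfDegree_of_forall_isSyzygy_baseChange`), and stable annihilation of the
base-changed cokernel is again a sandwich over the new ring (`stablyAnnihilates_baseChange_coker_iff`), which the
antidiagonal certificate refutes as soon as the new ring still maps to `k[X]/(X^{n+1})` with `u, w ↦ 0`, `z ↦ X`.

* **`An_pow_not_mem_cohomologyAnnihilatorOfDegree_baseChange`** — `Λ'` a flat noetherian `Λ_n`-algebra with a ring map
  `Φ' : Λ' → k[X]/(X^{n+1})` killing the images of `u, w` and sending the image of `z` to `X`: the image of `z^a` lies in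
  NO `caˢ(Λ')`, for `a < (n+1)/2 = ⌈n/2⌉`;
* **`An_pow_not_mem_cohomologyAnnihilator_baseChange`** — hence not in `ca(Λ')`.

Typical consumers: `Λ' = (Λ_n)_𝔪` (the local ring of the `A_n` point; `Φ'` = `IsLocalization.lift`, elements off
`𝔪 = (u,w,z)` have unit constant term in `k[X]/(X^{n+1})`), its henselisation/completion, or a tower stage `T_1` presented
as such an algebra.  What is NOT here: that presentation (the dictionary socket of the memo `HAND23-PLATEAU-DICHOTOMY.md`).

References: S. B. Iyengar, R. Takahashi, IMRN 2016, §2, Lemma 2.14, proof of Thm 5.4 [`IyengarTakahashi2014`].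
-/

noncomputable section

-- single-problem summit: the doubled namespace component `ResolutionOfSingularities` is forced
set_option linter.dupNamespace false

open CategoryTheory Literature.RingTheory.CohomologyAnnihilator
open scoped Matrix TensorProduct
open Summit.ResolutionOfSingularities.ResolutionOfSingularities.Theorems.NoZeno.SandwichCluster
open Summit.ResolutionOfSingularities.ResolutionOfSingularities.Theorems.HomologicalConductor.FrobeniusOrderSyzygy
open Summit.ResolutionOfSingularities.ResolutionOfSingularities.Theorems.HomologicalConductor.KC3WitnessTransport
open Summit.ResolutionOfSingularities.ResolutionOfSingularities.Theorems.HomologicalConductor.KC3WitnessBaseChange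

universe u

namespace Summit.ResolutionOfSingularities.ResolutionOfSingularities.Theorems.HomologicalConductor.PersistenceSurfacePlateauCertificate

section ModelAn

open MvPolynomial

variable (k : Type u) [Field k] (n : ℕ)

/-- The `A_n` coordinate ring `Λ_n = k[X₀,X₁,X₂]/(X₀X₁ − X₂^{n+1})` (local notation only). -/
local notation3 "Λ_[" k ", " n "]" =>
  MvPolynomial (Fin 3) k ⧸ Ideal.span {(X 0 * X 1 - X 2 ^ (n + 1) : MvPolynomial (Fin 3) k)}
/-- The quotient map `k[X₀,X₁,X₂] → Λ_n` (local notation only). -/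
local notation3 "π_[" k ", " n "]" =>
  Ideal.Quotient.mk (Ideal.span {(X 0 * X 1 - X 2 ^ (n + 1) : MvPolynomial (Fin 3) k)})

/-- **The plateau certificate after a flat base change, all levels.**  `Λ'` a flat noetherian `Λ_n`-algebra,
`Φ' : Λ' →+* k[X]/(X^{n+1})` with `Φ'(u) = Φ'(w) = 0`, `Φ'(z) = X` (images of `u, w, z` in `Λ'`); then for
`a < (n+1)/2` and every `s`, the image of `z^a` in `Λ'` is not in `caˢ(Λ')`.  Proof: `M_j = coker φ_j` (`j = (n+1)/2`) is an
infinite syzygy over `Λ_n` (`forall_isSyzygy_coker_of_matrixFactorization`), infinite syzygies base-change along flat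
algebras, and a stable annihilation of `Λ' ⊗ M_j` would be a sandwich for `φ_j ⊗ Λ'` over `Λ'`
(`stablyAnnihilates_baseChange_coker_iff`), refuted through `Φ'` by `not_stablyAnnihilates_coker_of_antidiagonal_truncated`.
[this work; cite: IyengarTakahashi2014, Lemma 2.14] -/
theorem An_pow_not_mem_cohomologyAnnihilatorOfDegree_baseChange (Λ' : Type u) [CommRing Λ'] [Algebra Λ_[k, n] Λ']
    [Module.Flat Λ_[k, n] Λ'] [IsNoetherianRing Λ']
    (Φ' : Λ' →+* Polynomial k ⧸ Ideal.span {(Polynomial.X : Polynomial k) ^ (n + 1)})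
    (h0 : Φ' (algebraMap Λ_[k, n] Λ' (π_[k, n] (X 0))) = 0)
    (h1 : Φ' (algebraMap Λ_[k, n] Λ' (π_[k, n] (X 1))) = 0)
    (h2 : Φ' (algebraMap Λ_[k, n] Λ' (π_[k, n] (X 2))) = Ideal.Quotient.mk _ Polynomial.X)
    (a : ℕ) (ha : a < (n + 1) / 2) (s : ℕ) :
    algebraMap Λ_[k, n] Λ' (π_[k, n] (X 2)) ^ a ∉ cohomologyAnnihilatorOfDegree Λ' s := by
  set j := (n + 1) / 2 with hj
  have haj : a < j := ha
  have hajn : a + j ≤ n := by omega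
  have hjn : j ≤ n + 1 := by omega
  -- the infinite syzygy `M_j` over `Λ_n`
  obtain ⟨hmf1, hmf2⟩ := An_isMatrixFactorization n (X 0 : MvPolynomial (Fin 3) k) (X 1) (X 2) j hjn
  have hφ : (!![π_[k, n] (X 0), π_[k, n] (X 2) ^ j; π_[k, n] (X 2) ^ (n + 1 - j), π_[k, n] (X 1)] :
      Matrix (Fin 2) (Fin 2) Λ_[k, n]) =
      (!![(X 0 : MvPolynomial (Fin 3) k), X 2 ^ j; X 2 ^ (n + 1 - j), X 1]).map π_[k, n] := by
    ext i l; fin_cases i <;> fin_cases l <;> simp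
  have hψ : (!![π_[k, n] (X 1), -π_[k, n] (X 2) ^ j; -π_[k, n] (X 2) ^ (n + 1 - j), π_[k, n] (X 0)] :
      Matrix (Fin 2) (Fin 2) Λ_[k, n]) =
      (!![(X 1 : MvPolynomial (Fin 3) k), -X 2 ^ j; -X 2 ^ (n + 1 - j), X 0]).map π_[k, n] := by
    ext i l; fin_cases i <;> fin_cases l <;> simp
  have hL := fun s => forall_isSyzygy_coker_of_matrixFactorization (m := Fin 2)
    (X 0 * X 1 - X 2 ^ (n + 1) : MvPolynomial (Fin 3) k) (An_rel_ne_zero k n) s _ _ hmf1 hmf2 _ _ hφ hψ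
  set D : Matrix (Fin 2) (Fin 2) Λ_[k, n] :=
    !![π_[k, n] (X 0), π_[k, n] (X 2) ^ j; π_[k, n] (X 2) ^ (n + 1 - j), π_[k, n] (X 1)] with hD
  -- the base-changed certificate
  have hx : ¬ StablyAnnihilates Λ' (algebraMap Λ_[k, n] Λ' (π_[k, n] (X 2)) ^ a)
      (ModuleCat.of Λ' (Λ' ⊗[Λ_[k, n]] ((Fin 2 → Λ_[k, n]) ⧸ LinearMap.range D.mulVecLin))) := by
    intro h
    rw [stablyAnnihilates_baseChange_coker_iff] at h
    have h' := (stablyAnnihilates_coker_iff_exists_mul_mul_eq' (D.map (algebraMap Λ_[k, n] Λ'))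
      (algebraMap Λ_[k, n] Λ' (π_[k, n] (X 2)) ^ a)).mpr h
    refine not_stablyAnnihilates_coker_of_antidiagonal_truncated n a j haj hajn Φ' (D.map (algebraMap Λ_[k, n] Λ'))
      _ 1 isUnit_one ?_ ?_ ?_ ?_ h'
    · simp [hD, h0]
    · simp [hD, h1]
    · simp [hD, map_pow, h2]
    · rw [map_pow, h2, one_mul]
  exact not_mem_cohomologyAnnihilatorOfDegree_of_forall_isSyzygy_baseChange Λ'
    ((Fin 2 → Λ_[k, n]) ⧸ LinearMap.range D.mulVecLin) hL hx s

/-- **`ca` form:** under the same hypotheses the image of `z^a` is not in `ca(Λ') = ⋃ₛ caˢ(Λ')`.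
[this work; cite: IyengarTakahashi2014, Lemma 2.14] -/
theorem An_pow_not_mem_cohomologyAnnihilator_baseChange (Λ' : Type u) [CommRing Λ'] [Algebra Λ_[k, n] Λ']
    [Module.Flat Λ_[k, n] Λ'] [IsNoetherianRing Λ']
    (Φ' : Λ' →+* Polynomial k ⧸ Ideal.span {(Polynomial.X : Polynomial k) ^ (n + 1)})
    (h0 : Φ' (algebraMap Λ_[k, n] Λ' (π_[k, n] (X 0))) = 0)
    (h1 : Φ' (algebraMap Λ_[k, n] Λ' (π_[k, n] (X 1))) = 0)
    (h2 : Φ' (algebraMap Λ_[k, n] Λ' (π_[k, n] (X 2))) = Ideal.Quotient.mk _ Polynomial.X)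
    (a : ℕ) (ha : a < (n + 1) / 2) :
    algebraMap Λ_[k, n] Λ' (π_[k, n] (X 2)) ^ a ∉ cohomologyAnnihilator Λ' := by
  rw [mem_cohomologyAnnihilator_iff]
  rintro ⟨s, hs⟩
  exact An_pow_not_mem_cohomologyAnnihilatorOfDegree_baseChange k n Λ' Φ' h0 h1 h2 a ha s hs

/-! ## Localisations of `Λ_n` at the singular point (appended by the same hand) -/

/-- **Units of the truncated polynomial ring.**  In `k[X]/(X^N)` (`k` a field) the class of a polynomial with non-zero
constant coefficient is a unit (`q = c + X·q'`, `c ≠ 0` a unit, `X·q'` nilpotent). [folklore] -/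
theorem isUnit_truncated_of_coeff_zero_ne_zero (N : ℕ) (q : Polynomial k) (hq : q.coeff 0 ≠ 0) :
    IsUnit (Ideal.Quotient.mk (Ideal.span {(Polynomial.X : Polynomial k) ^ N}) q) := by
  have hXN : Ideal.Quotient.mk (Ideal.span {(Polynomial.X : Polynomial k) ^ N}) Polynomial.X ^ N = 0 := by
    rw [← map_pow, Ideal.Quotient.eq_zero_iff_mem]; exact Ideal.mem_span_singleton_self _
  have hdecomp : Ideal.Quotient.mk (Ideal.span {(Polynomial.X : Polynomial k) ^ N}) q =
      Ideal.Quotient.mk (Ideal.span {(Polynomial.X : Polynomial k) ^ N}) (Polynomial.C (q.coeff 0)) +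
      Ideal.Quotient.mk (Ideal.span {(Polynomial.X : Polynomial k) ^ N}) Polynomial.X *
        Ideal.Quotient.mk (Ideal.span {(Polynomial.X : Polynomial k) ^ N}) q.divX := by
    conv_lhs => rw [← Polynomial.X_mul_divX_add q]
    rw [map_add, map_mul, add_comm]
  rw [hdecomp]
  refine IsNilpotent.isUnit_add_left_of_commute ⟨N, ?_⟩ ?_ (Commute.all _ _)
  · rw [mul_pow, hXN, zero_mul]
  · exact ((isUnit_iff_ne_zero.mpr hq).map Polynomial.C).map _

/-- **The reduction map `Φ₀ : Λ_n → k[X]/(X^{n+1})`, `u, w ↦ 0`, `z ↦ X`, exists** (the `A_n` equation maps to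
`−X^{n+1} = 0`), and sends the class of `p(X₀,X₁,X₂)` to the class of `p(0,0,X)`. [folklore] -/
theorem An_exists_reduction :
    ∃ Φ₀ : Λ_[k, n] →+* Polynomial k ⧸ Ideal.span {(Polynomial.X : Polynomial k) ^ (n + 1)},
      Φ₀ (π_[k, n] (X 0)) = 0 ∧ Φ₀ (π_[k, n] (X 1)) = 0 ∧
      Φ₀ (π_[k, n] (X 2)) = Ideal.Quotient.mk _ Polynomial.X ∧
      ∀ p : MvPolynomial (Fin 3) k, Φ₀ (π_[k, n] p) =
        Ideal.Quotient.mk _ (MvPolynomial.aeval ![(0 : Polynomial k), 0, Polynomial.X] p) := by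
  set I : Ideal (MvPolynomial (Fin 3) k) := Ideal.span {(X 0 * X 1 - X 2 ^ (n + 1) : MvPolynomial (Fin 3) k)}
    with hI
  set J : Ideal (Polynomial k) := Ideal.span {(Polynomial.X : Polynomial k) ^ (n + 1)} with hJ
  let ψ : MvPolynomial (Fin 3) k →+* Polynomial k ⧸ J :=
    (Ideal.Quotient.mk J).comp (MvPolynomial.aeval ![(0 : Polynomial k), 0, Polynomial.X]).toRingHom
  have hψ0 : ψ (X 0) = 0 := by simp [ψ]
  have hψ1 : ψ (X 1) = 0 := by simp [ψ]
  have hψ2 : ψ (X 2) = Ideal.Quotient.mk J Polynomial.X := by simp [ψ]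
  have hψf : ψ (X 0 * X 1 - X 2 ^ (n + 1)) = 0 := by
    rw [map_sub, map_mul, map_pow, hψ0, hψ2, zero_mul, zero_sub, neg_eq_zero, ← map_pow,
      Ideal.Quotient.eq_zero_iff_mem, hJ]
    exact Ideal.mem_span_singleton_self _
  have hIψ : ∀ p ∈ I, ψ p = 0 := by
    intro p hp
    rw [hI, Ideal.mem_span_singleton] at hp
    obtain ⟨q, rfl⟩ := hp
    rw [map_mul, hψf, zero_mul]
  refine ⟨Ideal.Quotient.lift I ψ hIψ, ?_, ?_, ?_, fun p => ?_⟩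
  · rw [Ideal.Quotient.lift_mk]; exact hψ0
  · rw [Ideal.Quotient.lift_mk]; exact hψ1
  · rw [Ideal.Quotient.lift_mk]; exact hψ2
  · rw [Ideal.Quotient.lift_mk]; rfl

/-- The constant coefficient survives the substitution `(X₀,X₁,X₂) ↦ (0,0,X)`: `p(0,0,X)(0) = p(0,0,0)`. [folklore] -/
theorem coeff_zero_aeval_line (p : MvPolynomial (Fin 3) k) :
    (MvPolynomial.aeval ![(0 : Polynomial k), 0, Polynomial.X] p).coeff 0 = MvPolynomial.constantCoeff p := by
  rw [Polynomial.coeff_zero_eq_eval_zero, ← Polynomial.coe_aeval_eq_eval,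
    ← AlgHom.comp_apply, MvPolynomial.comp_aeval]
  have h0 : (fun i => (Polynomial.aeval (0 : k)) ((![(0 : Polynomial k), 0, Polynomial.X] : Fin 3 → Polynomial k) i)) =
      (0 : Fin 3 → k) := by
    funext i; fin_cases i <;> simp
  rw [h0, MvPolynomial.aeval_zero, Algebra.algebraMap_self, RingHom.id_apply]

/-- **The plateau certificate at a LOCALISATION of `Λ_n` whose denominators have non-zero constant term** — in particular
at the local ring `(Λ_n)_𝔪` of the singular point `𝔪 = (u,w,z)`: the image of `z^a` lies in no `caˢ`, `a < (n+1)/2 = ⌈n/2⌉`.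
(`Φ'` = `IsLocalization.lift` of the reduction map: denominators become units of `k[X]/(X^{n+1})`.)
[this work; cite: IyengarTakahashi2014, Lemma 2.14] -/
theorem An_pow_not_mem_cohomologyAnnihilatorOfDegree_localization (M : Submonoid Λ_[k, n]) (Λ' : Type u)
    [CommRing Λ'] [Algebra Λ_[k, n] Λ'] [IsLocalization M Λ']
    (hM : ∀ p : MvPolynomial (Fin 3) k, π_[k, n] p ∈ M → MvPolynomial.constantCoeff p ≠ 0)
    (a : ℕ) (ha : a < (n + 1) / 2) (s : ℕ) :
    algebraMap Λ_[k, n] Λ' (π_[k, n] (X 2)) ^ a ∉ cohomologyAnnihilatorOfDegree Λ' s := by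
  obtain ⟨Φ₀, h0, h1, h2, hΦ⟩ := An_exists_reduction k n
  have hunits : ∀ y : M, IsUnit (Φ₀ y) := by
    rintro ⟨y, hy⟩
    obtain ⟨p, rfl⟩ := Ideal.Quotient.mk_surjective y
    rw [hΦ]
    exact isUnit_truncated_of_coeff_zero_ne_zero k (n + 1) _ (by rw [coeff_zero_aeval_line]; exact hM p hy)
  haveI : Module.Flat Λ_[k, n] Λ' := IsLocalization.flat Λ' M
  haveI : IsNoetherianRing Λ' := IsLocalization.isNoetherianRing M Λ' inferInstance
  refine An_pow_not_mem_cohomologyAnnihilatorOfDegree_baseChange k n Λ' (IsLocalization.lift hunits) ?_ ?_ ?_ a ha s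
  · rw [IsLocalization.lift_eq]; exact h0
  · rw [IsLocalization.lift_eq]; exact h1
  · rw [IsLocalization.lift_eq]; exact h2

/-- **At the singular point.**  For any prime `𝔭` of `Λ_n` containing the classes of all polynomials without constant term
(i.e. `𝔭 ⊇ (u, w, z)`, so `𝔭` IS the maximal ideal of the `A_n` point): in the local ring `(Λ_n)_𝔭` the image of `z^a` lies in
no `caˢ((Λ_n)_𝔭)` and not in `ca((Λ_n)_𝔭)`, for `a < (n+1)/2 = ⌈n/2⌉` — the sharp non-membership half of
`ca(A_n) = (u, w, z^{⌈n/2⌉})` at the local ring. [this work; cite: IyengarTakahashi2014, Lemma 2.14] -/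
theorem An_pow_not_mem_cohomologyAnnihilator_atPrime (𝔭 : Ideal Λ_[k, n]) [𝔭.IsPrime]
    (h𝔭 : ∀ p : MvPolynomial (Fin 3) k, MvPolynomial.constantCoeff p = 0 → π_[k, n] p ∈ 𝔭)
    (a : ℕ) (ha : a < (n + 1) / 2) :
    (∀ s : ℕ, algebraMap Λ_[k, n] (Localization.AtPrime 𝔭) (π_[k, n] (X 2)) ^ a ∉
      cohomologyAnnihilatorOfDegree (Localization.AtPrime 𝔭) s) ∧
    algebraMap Λ_[k, n] (Localization.AtPrime 𝔭) (π_[k, n] (X 2)) ^ a ∉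
      cohomologyAnnihilator (Localization.AtPrime 𝔭) := by
  have hM : ∀ p : MvPolynomial (Fin 3) k, π_[k, n] p ∈ 𝔭.primeCompl → MvPolynomial.constantCoeff p ≠ 0 :=
    fun p hp hc => hp (h𝔭 p hc)
  have hs := An_pow_not_mem_cohomologyAnnihilatorOfDegree_localization k n 𝔭.primeCompl (Localization.AtPrime 𝔭) hM a ha
  refine ⟨hs, ?_⟩
  rw [mem_cohomologyAnnihilator_iff]
  rintro ⟨s, h⟩
  exact hs s h

end ModelAn

end Summit.ResolutionOfSingularities.ResolutionOfSingularities.Theorems.HomologicalConductor.PersistenceSurfacePlateauCertificate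

end
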